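import Literature.MathematicalPhysics.QuantumLattice.HubbardScaleReport

/-!
# Subadditivity of the leg-weighted `L¹–L^∞` kernel norm
# (crux `SeededBrokenRegimeBoseFermiPinned` = stmt-HubbardSuperconductivity-14047, route AposterioriCapRg; supports, lead c4; stub `stub_legKernelNormAddLe`)

WHAT. Salmhofer's leg-weighted `L¹–L^∞` kernel norm
(`legKernelNorm`, `Literature/MathematicalPhysics/QuantumLattice/HubbardScaleReport.lean`, §3) is
subadditive: `‖K + K'‖_{wt,ε} ≤ ‖K‖_{wt,ε} + ‖K'‖_{wt,ε}` for nonnegative leg weights `wt` and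
`ε ≥ 0` — the triangle inequality every norm estimate of a SUM of Grassmann polynomials goes through
(the right-hand side of Polchinski's equation is a sum of three terms).

HOW. Degree `0`: the norm is `‖K ∅‖`, so this is `norm_add_le`.  Degree `m + 1`: the norm is the
finite supremum over a distinguished leg `p` and its label `x` of the weighted pinned fibre sum
`ε ^ m · Σ_{X : X p = x} (∏_q wt (X q)) · ‖K X‖` (`legKernelNorm_succ`).  Pointwise
`‖(K + K') X‖ ≤ ‖K X‖ + ‖K' X‖` and the weight `∏_q wt (X q)` is nonnegative, so every pinned sum of
`K + K'` is at most the pinned sum of `K` plus that of `K'` (`pinnedSum_add_le`); each pinned sum of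
`K` is at most `‖K‖_{wt,ε}` (a value is at most a finite supremum, `pinnedSum_le_legKernelNorm`); and
the norm of `K + K'` is at most any nonnegative bound of all its pinned sums
(`legKernelNorm_succ_le_of_forall`; for empty `Γ` the supremum is `0`).

SOURCES. M. Salmhofer, Commun. Math. Phys. 194 (1998) 249–295, §4.1 (the norm, before Lemma 1)
[`Salmhofer1998`]; the inequality itself is finite-dimensional bookkeeping, folklore.

The file proves the generic lemmas over any `RCLike` scalar field and any finite label type in the
sub-namespace `LegKernelNormAlgebra` (weighted copies of `pinnedSum_le_kernelNorm` and
`kernelNorm_succ_le_of_forall` of `GrassmannKernelsPresented.lean`), then the registered stub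
(scalars `ℂ`).
-/

set_option linter.dupNamespace false -- `Summit.<S>.<S>` doubles the summit name (tree convention)

namespace Summit.HubbardSuperconductivity.HubbardSuperconductivity.Theorems.AposterioriCapRgSeededBrokenRegimeBoseFermiPinned

open Literature.MathematicalPhysics.QuantumLattice GrassmannAlgebra

namespace LegKernelNormAlgebra

variable {𝕜 : Type*} [RCLike 𝕜] {Γ : Type*} [Fintype Γ] [DecidableEq Γ]

/-- Each weighted pinned sum is at most the leg-weighted norm (a value is at most a finite
supremum) — the weighted copy of `pinnedSum_le_kernelNorm`. [folklore] -/
theorem pinnedSum_le_legKernelNorm (wt : Γ → ℝ) (ε : ℝ) (m : ℕ) (K : (Fin (m + 1) → Γ) → 𝕜)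
    (p : Fin (m + 1)) (x : Γ) :
    ε ^ m * ∑ X ∈ Finset.univ.filter (fun X : Fin (m + 1) → Γ => X p = x), (∏ q, wt (X q)) * ‖K X‖ ≤
      legKernelNorm wt ε (m + 1) K := by
  rw [legKernelNorm_succ]
  exact le_ciSup_of_le (Finite.bddAbove_range _) p
    (le_ciSup_of_le (Finite.bddAbove_range _) x le_rfl)

/-- The leg-weighted norm in positive degree is at most `B ≥ 0` when every weighted pinned sum is
(for empty `Γ` the supremum is `0 ≤ B`) — the weighted copy of `kernelNorm_succ_le_of_forall`.
[folklore] -/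
theorem legKernelNorm_succ_le_of_forall (wt : Γ → ℝ) (ε : ℝ) (m : ℕ) (K : (Fin (m + 1) → Γ) → 𝕜)
    {B : ℝ} (hB : 0 ≤ B)
    (h : ∀ (p : Fin (m + 1)) (x : Γ),
      ε ^ m * ∑ X ∈ Finset.univ.filter (fun X : Fin (m + 1) → Γ => X p = x),
        (∏ q, wt (X q)) * ‖K X‖ ≤ B) :
    legKernelNorm wt ε (m + 1) K ≤ B := by
  rw [legKernelNorm_succ]
  rcases isEmpty_or_nonempty Γ with hΓ | hΓ
  · simp [hB]
  · exact ciSup_le fun p => ciSup_le fun x => h p x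

/-- The weighted pinned sum of `K + K'` is at most that of `K` plus that of `K'`, for nonnegative
weights and `ε ≥ 0` (pointwise `‖(K + K') X‖ ≤ ‖K X‖ + ‖K' X‖`, `Finset.sum_add_distrib`,
`mul_add`). [folklore] -/
theorem pinnedSum_add_le {wt : Γ → ℝ} (hwt : ∀ Y, 0 ≤ wt Y) {ε : ℝ} (hε : 0 ≤ ε) (m : ℕ)
    (K K' : (Fin (m + 1) → Γ) → 𝕜) (p : Fin (m + 1)) (x : Γ) :
    ε ^ m * ∑ X ∈ Finset.univ.filter (fun X : Fin (m + 1) → Γ => X p = x),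
        (∏ q, wt (X q)) * ‖(K + K') X‖ ≤
      ε ^ m * ∑ X ∈ Finset.univ.filter (fun X : Fin (m + 1) → Γ => X p = x),
          (∏ q, wt (X q)) * ‖K X‖ +
        ε ^ m * ∑ X ∈ Finset.univ.filter (fun X : Fin (m + 1) → Γ => X p = x),
          (∏ q, wt (X q)) * ‖K' X‖ := by
  rw [← mul_add, ← Finset.sum_add_distrib]
  refine mul_le_mul_of_nonneg_left (Finset.sum_le_sum fun X _ => ?_) (pow_nonneg hε m)
  rw [← mul_add, Pi.add_apply]
  exact mul_le_mul_of_nonneg_left (norm_add_le _ _) (Finset.prod_nonneg fun q _ => hwt _)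

/-- **Subadditivity of the leg-weighted `L¹–L^∞` norm** (generic labels and scalars):
`‖K + K'‖_{wt,ε} ≤ ‖K‖_{wt,ε} + ‖K'‖_{wt,ε}` for nonnegative weights `wt` and `ε ≥ 0`.
[cite: Salmhofer1998, §4.1] -/
theorem legKernelNorm_add_le {wt : Γ → ℝ} (hwt : ∀ Y, 0 ≤ wt Y) {ε : ℝ} (hε : 0 ≤ ε) (m : ℕ)
    (K K' : (Fin m → Γ) → 𝕜) :
    legKernelNorm wt ε m (K + K') ≤ legKernelNorm wt ε m K + legKernelNorm wt ε m K' := by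
  cases m with
  | zero =>
    simp only [legKernelNorm_zero_left, Pi.add_apply]
    exact norm_add_le _ _
  | succ m =>
    refine legKernelNorm_succ_le_of_forall wt ε m (K + K')
      (add_nonneg (legKernelNorm_nonneg hwt hε _ K) (legKernelNorm_nonneg hwt hε _ K')) fun p x => ?_
    exact (pinnedSum_add_le hwt hε m K K' p x).trans
      (add_le_add (pinnedSum_le_legKernelNorm wt ε m K p x)
        (pinnedSum_le_legKernelNorm wt ε m K' p x))

end LegKernelNormAlgebra

/-! ### The registered stub -/

/-- **`stub_legKernelNormAddLe`**: subadditivity of Salmhofer's leg-weighted `L¹–L^∞` kernel norm,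
`‖K + K'‖_{wt,ε} ≤ ‖K‖_{wt,ε} + ‖K'‖_{wt,ε}` for nonnegative leg weights and `ε ≥ 0` (complex
kernels, any finite label type). [cite: Salmhofer1998, §4.1] -/
theorem stub_legKernelNormAddLe :
    ∀ {Γ : Type} [Fintype Γ] [DecidableEq Γ] (wt : Γ → ℝ), (∀ X, 0 ≤ wt X) → ∀ {ε : ℝ}, 0 ≤ ε →
      ∀ (m : ℕ) (K K' : (Fin m → Γ) → ℂ),
        legKernelNorm wt ε m (K + K') ≤ legKernelNorm wt ε m K + legKernelNorm wt ε m K' := by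
  intro Γ _ _ wt hwt ε hε m K K'
  exact LegKernelNormAlgebra.legKernelNorm_add_le hwt hε m K K'

end Summit.HubbardSuperconductivity.HubbardSuperconductivity.Theorems.AposterioriCapRgSeededBrokenRegimeBoseFermiPinned
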